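import Literature.MathematicalPhysics.QuantumFieldTheory.Balaban1983to89.B9Eq343HolderBothZdFinite
import Literature.MathematicalPhysics.QuantumFieldTheory.Balaban1983to89.B9SupplySockB9P3ZdGammaUnivDelta2
import Literature.MathematicalPhysics.QuantumFieldTheory.Balaban1983to89.B9Lemma21ShellCrossingZd

/-!
# `Balaban1983to89.B9Eq343HolderDelta2ZdFinite` — [Balaban1985RegularSpaces] (1.36) p. 82 ∕ (1.59) p. 86 ∕ Prop. 3 p. 87 «on Ω_j», [Balaban1985BackgroundPropagators]
# Thm 3.3 (3.42)+(3.43) pp. 397–399: THE RE-TYPED HÖLDER BINDER `HolderAtδ2` (dag-n06-b EDITION δ₂, both points in Ω_j, fed (3.42)+(3.43)) IS A THEOREM ON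
# EVERY FINITE MEMBER, FOR ARBITRARY SOURCE FIELDS `J`, at ANY ℝ-linear letter `G(U₀)` that reads `J` on the bonds of `Ω₀` only — with a member-dependent
# constant (the Lemma-2.1 letters at `κ₂ := 0`); the source-block assignment now allows the bonds whose TIP (not base) lies in `Ω₀`

statement-level skeleton of published theorems with citation tags; proofs where landed; nothing here is a claim about the
Yang–Mills mass gap

PDF held: `paper:balaban1985-cmp99-background-propagators` ([4] = B9) pp. 397–398; `paper:balaban1985-cmp99-regular-spaces-gauge-fixing` (B8) pp. 82, 86–87; [4] =
[Balaban1984PropagatorsII] Lemma 2.1 p. 234 — through the audited headers of `B9Eq347GlobalFromLocal` (leaf-03), `B9Eq347GlobalFromLocalZd` (g0), this seat's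
`B9Eq343HolderGlobalFromLocalZd` ∕ `…CutoffFamilyZd` ∕ `…HolderBothZdFinite`, and dag-n06-b's `B9SupplySockB9P3ZdGammaUnivDelta2` (the binder) — BY NAME.

WHY THIS FILE (cell `pub-ymgap`, HUMAN RULING D-0062 ∕ D-0149; seat `pub-ymgap-dag-n06-w2` (g2), node N06 = [B9]; INTENT-7; count-neutral).  dag-n06-b re-typed the
junction's Hölder binder to this seat's located reading (`HolderAtδ2`: class `q.2.2 ∈ AdmPair ∧ q.2.2.1 ∈ Ω_j ∧ q.2.2.2 ∈ Ω_j`, inputs `0 < δ₀ ∧ Ineq342_346_347 ∧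
Ineq343_345`, constant `CH δ₀·(B₀ + max 0 (Bβ β))·|J|₍₋₃₎`, p598001).  `B9Eq343HolderBothZdFinite.holderBoth_msup_le_CH` supplies exactly that shape — for sources
`f̃ = extZd P f` on a class whose bonds have their BASE point in a block.  The binder quantifies over ALL `J`: the genuine `G(U₀)` (dag-n06-w4's `gopZd`) reads `J`
on the bonds touching `Ω₀`, including the bonds `⟨z, z + e_μ⟩` with `z ∉ Ω₀`, `z + e_μ ∈ Ω₀`, whose base lies in NO block.  This file re-runs the summation with a
block assignment that only asks the bond to TOUCH its block (print's «supp λ ⊂ Δ(y′)» in the p. 77 bond convention — the shape the (3.42)∕(3.43) readings already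
use), keeps base-assignment where the base is a site of `Ω₀` (the output side needs it), and discharges `HolderAtδ2` at the frame on every finite member, for
every letter record whose `G(U₀)` is ℝ-linear and Ω₀-restricted (`G(U)J = G(U)(𝟙_{Ω₀-bonds}J)`), with the member's Lemma-2.1 constants.

WHAT IS PROVED (0 sorry; proof lane — no `def`).
* §1 TOUCH-ASSIGNED SUMMATIONS (the hypothesis `hπ : b.1.1 ∈ blockZd (π b)` of g0∕INTENT-1 weakened to `hπ' : BondTouches (blockZd (π b)) b.1.1 b.1.2`):
  `weight_mul_norm_le_of_reading'` + `weight_mul_norm_gradGop_le_of_ineq342'` (g0's sup road), `weight_mul_hquot_cut_le_of_local'` +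
  `weight_mul_hquot_gradGop_le_of_ineq343'` (INTENT-1's Hölder road) — same proofs, two `Or.inl` fewer.
* §2 ★★ `weight_mul_hquot_gradGop_le_both'` + `holderBoth_msup_le_CH'` — INTENT-3's pointwise ∕ msup bound with the touch-assigned source class and a base-assignment
  clause `hπbase` only for bonds based at a site of some `Ω_j` (those carry the output points).
* §3 `restrictDom_eq_extZd` (`𝟙_{Ω₀-bonds}J = extZd P (J|P)` for `P` = «touches Ω₀»), `bdd_neg_three_of_finite` (on a finite member every `J` has a bounded
  `(−3)`-family), `B0_nonneg_of_ineq342_zd` (the (3.42) reading at a one-bond bump pins `0 ≤ B₀` whenever a block and a direction exist).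
* §4 ★★★ `holderAtδ2_zd_of_finite` — `HolderAtδ2 (geoZd …) (bgZd …) (GAZdFamOfOps … ops) L memZd (ιCfgZd …) ops β len CH M i m` on a member with `(i.Ω 0).Finite`,
  `[Fintype 𝔅]`, `1 ≤ L`, `0 ≤ β < 1`, `len` with `1 ≤ len` ∧ `|·|_∞ ≤ len`, laws (T) «level-j block ⊆ Ω_j» (G1′) «sites of Ω_j (j ≤ m) lie in blocks» (G2′) «a level-j_y block
  meets Ω_j only for j ≤ j_y», and a letter record whose `G(U₀)` at `(M, i, m)` is ℝ-linear and Ω₀-restricted — with `CH := fun _ => max (R_H·|𝔅|) (2·4^β·R₁·|𝔅|)`, the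
  member's own Lemma-2.1 constants (`exchangeLetter_of_fintype`, `rowLetter_of_fintype`).
HONEST SCOPE.  Bookkeeping over landed summations; member-DEPENDENT constant (print's member-uniform constant needs the ξ-scaled cut-off norm (L-H2) + [4] Lemma 2.1
(2.61) in print's regime); nothing of [4] Thm 3.1∕3.3 asserted (`h342`, `h345` are the binder's own inputs); `G(U₀)` is ANY ℝ-linear Ω₀-restricted letter (the
genuine `gopZd` qualifies: `gopZd_add` + `restrictLin`, its ℝ-homogeneity being dag-n06-w4's to state); the univ road is not covered.  Count-neutral; N05∕N06 NOT
discharged; one finite lattice programme at fixed `ε`; R4 closes the conditional finite-𝕋⁴ rung `BalabanLadder.UV` only; nothing continuum ∕ ℝ⁴ ∕ OS ∕ mass-gap ∕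
Clay.  Unit `pub-ymgap-dag-n06-w2` (g2), 2026-08-28.
-/

noncomputable section

namespace Literature.MathematicalPhysics.QuantumFieldTheory.Balaban1983to89.B9Eq343HolderDelta2ZdFinite

open B7Prop1Local (InBox)
open B7Prop1Explicit (e)
open B7Prop2Explicit (unitaryUnits)
open B8Ineq132 (covDerivFwd BondTouches)
open B8ScaledSupNorm (msup weight Bdd weight_mul_norm_le_msup bondNorm)
open B8LeafModelZd (ZdIdx)
open B9Eq340HolderZd (hquot AdmPair hquot_nonneg)
open B9SupplySockB9P3ZdLetters (OpsZd)
open B9SupplySockB9P3ZdLettersOmega (restrictDom)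
open B9SupplySockB9P3ZdFrame (MemberZd memZd BSite blockZd blockTZd CfgZd geoZd bgZd ιCfgZd distZd supNormZd cutHZd)
open B9SupplySockB9P3ZdLocalLettersOfOps (cdBZd cutMulZd supBlkZd eOfOps GAZdOfOps GAZdFamOfOps ineq342_of_GAZdOfOps)
open B9Eq347GlobalFromLocal (weight_mul_norm_apply_le_of_local)
open B9Eq347GlobalFromLocalZd (extZd extZd_apply_of extZd_apply_of_not extZd_add extZd_smul norm_le_supBlkZd supNormZd_le_of_forall cdBZd_linear comp_linear
  finite_bondTouches)
open B9Lemma21ShellCrossingZd (Omega_antitone blockZd_nonempty)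
open B9Eq347GlobalFromLocalZdFinite (exchangeLetter_of_fintype rowLetter_of_fintype exchangeConst_nonneg)
open B9Eq343HolderGlobalFromLocalZd (hquot_eq_norm_smul hquot_zero_fun hquot_cutMulZd_of_eq_one cutMulZd_linear locHolder_grad_of_ineq343 blockFactor_nonneg
  weight_mul_hquot_le_of_far)
open B9Eq343CutoffFamilyZd (zetaZd coreZd zetaZd_eq_one_of_mem_blockZd zetaZd_eq_one_of_mem_coreZd mem_blockTZd_of_zetaZd_ne_zero)
open B9Eq343HolderBothZdFinite (scale_mono weight_holder_le weight_two_le quarter_scale_le_len)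
open B9SupplySockB9P3ZdSrc (trans_add)
open B9SupplySockB9P3ZdGammaUnivDelta2 (HolderAtδ2)
open LatticeNorms (linfDist)

-- `Site` alone could resolve to the torus sites of `Setup.lean`; re-export the `ℤ^d` sites of `B7Prop1Explicit`.
export B7Prop1Explicit (Site)

variable {d : ℕ}

/-! ## §1 The summations with a TOUCH-assigned source class -/

section Touch

variable {𝔸 : Type} [CStarAlgebra 𝔸] {L : ℕ} {len : Site d → ℝ}

/-- **g0's generic sup-road summation with touch-assignment** (`B9Eq347GlobalFromLocalZd.weight_mul_norm_le_of_reading` with `hπ` weakened to «the bond touches its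
block»). [cite: Balaban1985BackgroundPropagators, Thm 3.1 (3.42) p.397 + (3.47) p.398 (l.19–20); Balaban1984PropagatorsII, Lemma 2.1 (2.60)–(2.61) p.234; Balaban1985RegularSpaces, p.77 (bond convention)] -/
theorem weight_mul_norm_le_of_reading' {x : MemberZd d L} [Fintype (BSite L x)] {ops : OpsZd d 𝔸} {U : CfgZd d 𝔸}
    {B₀ δ₀ : ℝ} (hB₀ : 0 ≤ B₀) (h342 : B9.Ineq342_346_347 (GAZdOfOps 𝔸 L len x ops) B₀ δ₀ U)
    (n : Fin 4) (Θ : (Site d → Fin d → 𝔸) → (Site d → Fin d → 𝔸))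
    (hΘ : ∀ (c : ℝ) (A B : Site d → Fin d → 𝔸), Θ (c • A + B) = c • Θ A + Θ B)
    {P : Site d × Fin d → Prop} (π : {b : Site d × Fin d // P b} → BSite L x)
    (hπ' : ∀ b, BondTouches (blockZd L (π b).1.1 (π b).1.2) b.1.1 b.1.2)
    (hdom : ∀ (J : Site d → Fin d → 𝔸) (b : {b : Site d × Fin d // P b}), ‖Θ J b.1.1 b.1.2‖ ≤ eOfOps 𝔸 L ops x n U J (π b))
    {κ₂ R S : ℝ} (hR : 0 ≤ R) {ω ω' : BSite L x → ℝ} (hω : ∀ v, 0 < ω v) (hω' : ∀ u, 0 ≤ ω' u)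
    (hex : ∀ u v : BSite L x, ω' u * B9.pref4 ((L : ℝ) ^ u.1.1 * x.i.η) n ≤ R * Real.exp (κ₂ * distZd L x u v) * ω v)
    (hS : ∀ u : BSite L x, ∑ v, Real.exp (-((δ₀ - κ₂) * distZd L x u v)) ≤ S)
    (f : {b : Site d × Fin d // P b} → 𝔸) {M : ℝ} (hM : 0 ≤ M) (hMf : ∀ y, ω (π y) * ‖f y‖ ≤ M)
    (b : {b : Site d × Fin d // P b}) :
    ω' (π b) * ‖Θ (extZd P f) b.1.1 b.1.2‖ ≤ B₀ * R * S * M := by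
  have hΘ0 : Θ (0 : Site d → Fin d → 𝔸) = 0 := by
    have h1 := hΘ 1 (0 : Site d → Fin d → 𝔸) 0
    rw [one_smul, one_smul, add_zero] at h1
    have : Θ 0 + Θ 0 = Θ 0 + 0 := by rw [add_zero]; exact h1.symm
    exact add_left_cancel this
  let T : ({b : Site d × Fin d // P b} → 𝔸) →ₗ[ℝ] ({b : Site d × Fin d // P b} → 𝔸) :=
    { toFun := fun g b => Θ (extZd P g) b.1.1 b.1.2
      map_add' := fun g g' => by
        funext b'
        have h := hΘ 1 (extZd P g) (extZd P g')
        rw [one_smul, one_smul] at h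
        rw [extZd_add, h]
        rfl
      map_smul' := fun c g => by
        funext b'
        have h := hΘ c (extZd P g) 0
        rw [add_zero, hΘ0, add_zero] at h
        rw [extZd_smul, h]
        rfl }
  have hloc : ∀ (v : BSite L x) (g : {b : Site d × Fin d // P b} → 𝔸) (F : ℝ), (∀ y, π y ≠ v → g y = 0) → (∀ y, ‖g y‖ ≤ F) →
      ∀ b', ‖T g b'‖ ≤ B₀ * (fun u : BSite L x => B9.pref4 ((L : ℝ) ^ u.1.1 * x.i.η) n) (π b') *
        Real.exp (-(δ₀ * distZd L x (π b') v)) * F := by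
    intro v g F hgv hgF b'
    have hF0 : 0 ≤ F := (norm_nonneg _).trans (hgF b')
    have hsupp : ∀ (z : Site d) (μ : Fin d), extZd P g z μ ≠ 0 → BondTouches (blockZd L v.1.1 v.1.2) z μ := by
      intro z μ hne
      classical
      by_cases hP : P (z, μ)
      · have hy : π ⟨(z, μ), hP⟩ = v := by
          by_contra hne'
          exact hne (by rw [show extZd P g z μ = g ⟨(z, μ), hP⟩ from extZd_apply_of g ⟨(z, μ), hP⟩, hgv _ hne'])
        have hmem := hπ' ⟨(z, μ), hP⟩
        rw [hy] at hmem
        exact hmem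
      · exact absurd (extZd_apply_of_not g hP) hne
    have h1 := ineq342_of_GAZdOfOps (𝔸 := 𝔸) (L := L) (len := len) h342 n (extZd P g) (π b') v hsupp
    have h2 : ‖T g b'‖ ≤ eOfOps 𝔸 L ops x n U (extZd P g) (π b') := hdom (extZd P g) b'
    have h3 : supNormZd (extZd P g) ≤ F := by
      refine supNormZd_le_of_forall hF0 fun z μ => ?_
      classical
      by_cases hP : P (z, μ)
      · rw [show extZd P g z μ = g ⟨(z, μ), hP⟩ from extZd_apply_of g ⟨(z, μ), hP⟩]; exact hgF _
      · rw [extZd_apply_of_not g hP, norm_zero]; exact hF0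
    have hpref : 0 ≤ B9.pref4 ((L : ℝ) ^ (π b').1.1 * x.i.η) n := by
      have hs : 0 ≤ (L : ℝ) ^ (π b').1.1 * x.i.η := by have := x.i.hη.le; positivity
      fin_cases n <;> simp [B9.pref4] <;> positivity
    have h4 : 0 ≤ B₀ * B9.pref4 ((L : ℝ) ^ (π b').1.1 * x.i.η) n * Real.exp (-(δ₀ * distZd L x (π b') v)) := by positivity
    calc ‖T g b'‖ ≤ eOfOps 𝔸 L ops x n U (extZd P g) (π b') := h2
      _ ≤ B₀ * B9.pref4 ((L : ℝ) ^ (π b').1.1 * x.i.η) n * Real.exp (-(δ₀ * distZd L x (π b') v)) * supNormZd (extZd P g) := h1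
      _ ≤ B₀ * B9.pref4 ((L : ℝ) ^ (π b').1.1 * x.i.η) n * Real.exp (-(δ₀ * distZd L x (π b') v)) * F :=
          mul_le_mul_of_nonneg_left h3 h4
  exact weight_mul_norm_apply_le_of_local π π (distZd L x) T (κ := δ₀) (κ₂ := κ₂)
    (a := fun u : BSite L x => B9.pref4 ((L : ℝ) ^ u.1.1 * x.i.η) n) hB₀ hR hω hω' hloc hex hS f hM hMf b

/-- **g0's n = 1 entry with touch-assignment**: `ω′(π b)·‖(∇_{U,ν}G(U)f̃)(b)‖ ≤ B₀·R·S·M`. [cite: Balaban1985BackgroundPropagators, (3.47) p.398, (3.42) p.397; Balaban1984PropagatorsII, Lemma 2.1 p.234] -/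
theorem weight_mul_norm_gradGop_le_of_ineq342' {x : MemberZd d L} [Fintype (BSite L x)] {ops : OpsZd d 𝔸} {U : CfgZd d 𝔸}
    {B₀ δ₀ : ℝ} (hB₀ : 0 ≤ B₀) (h342 : B9.Ineq342_346_347 (GAZdOfOps 𝔸 L len x ops) B₀ δ₀ U)
    (hlin : ∀ (c : ℝ) (A B : Site d → Fin d → 𝔸), ops.Gop U.1 (c • A + B) = c • ops.Gop U.1 A + ops.Gop U.1 B)
    {P : Site d × Fin d → Prop} (π : {b : Site d × Fin d // P b} → BSite L x)
    (hπ' : ∀ b, BondTouches (blockZd L (π b).1.1 (π b).1.2) b.1.1 b.1.2)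
    {κ₂ R S : ℝ} (hR : 0 ≤ R) {ω ω' : BSite L x → ℝ} (hω : ∀ v, 0 < ω v) (hω' : ∀ u, 0 ≤ ω' u)
    (hex : ∀ u v : BSite L x, ω' u * ((L : ℝ) ^ u.1.1 * x.i.η) ≤ R * Real.exp (κ₂ * distZd L x u v) * ω v)
    (hS : ∀ u : BSite L x, ∑ v, Real.exp (-((δ₀ - κ₂) * distZd L x u v)) ≤ S)
    (ν : Fin d) (f : {b : Site d × Fin d // P b} → 𝔸) {M : ℝ} (hM : 0 ≤ M) (hMf : ∀ y, ω (π y) * ‖f y‖ ≤ M)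
    (b : {b : Site d × Fin d // P b}) :
    ω' (π b) * ‖cdBZd x.i.η U.1 ν (ops.Gop U.1 (extZd P f)) b.1.1 b.1.2‖ ≤ B₀ * R * S * M := by
  refine weight_mul_norm_le_of_reading' hB₀ h342 1 (fun J => cdBZd x.i.η U.1 ν (ops.Gop U.1 J))
    (comp_linear (cdBZd_linear x.i.η U.1 ν) hlin) π hπ' ?_ hR hω hω' (fun u v => by simpa [B9.pref4] using hex u v) hS f hM hMf b
  intro J b'
  have h1 : ‖cdBZd x.i.η U.1 ν (ops.Gop U.1 J) b'.1.1 b'.1.2‖ ≤ supBlkZd L (π b') (cdBZd x.i.η U.1 ν (ops.Gop U.1 J)) :=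
    norm_le_supBlkZd L (π b') _ (hπ' b')
  have h2 : supBlkZd L (π b') (cdBZd x.i.η U.1 ν (ops.Gop U.1 J)) ≤
      ⨆ ν' : Fin d, supBlkZd L (π b') (cdBZd x.i.η U.1 ν' (ops.Gop U.1 J)) :=
    le_ciSup (f := fun ν' : Fin d => supBlkZd L (π b') (cdBZd x.i.η U.1 ν' (ops.Gop U.1 J))) (Set.finite_range _).bddAbove ν
  simpa [eOfOps] using h1.trans h2

-- budget line: one `LinearMap` literal with two `funext`-proofs and a blockwise summation; elaborates inside the default today, margin for Mathlib drift
set_option maxHeartbeats 400000 in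
/-- **INTENT-1's generic Hölder summation with touch-assignment** (`B9Eq343HolderGlobalFromLocalZd.weight_mul_hquot_cut_le_of_local` with `hπ` weakened).
[cite: Balaban1985BackgroundPropagators, (3.43) p.398 + p.398 l.17–20, (3.40) p.397; Balaban1984PropagatorsII, Lemma 2.1 (2.60)–(2.61) p.234; Balaban1985RegularSpaces, (1.36) p.82, p.77] -/
theorem weight_mul_hquot_cut_le_of_local' {x : MemberZd d L} [Fintype (BSite L x)] (U : CfgZd d 𝔸) (β : ℝ)
    (Θ : (Site d → Fin d → 𝔸) → (Site d → Fin d → 𝔸))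
    (hΘ : ∀ (c : ℝ) (A B : Site d → Fin d → 𝔸), Θ (c • A + B) = c • Θ A + Θ B)
    (ζ : BSite L x → Site d → ℝ) {B δ₀ : ℝ} (hB : 0 ≤ B) {a : BSite L x → ℝ} (ha : ∀ u, 0 ≤ a u)
    (hloc : ∀ (u v : BSite L x) (J : Site d → Fin d → 𝔸),
      (∀ (z : Site d) (μ : Fin d), J z μ ≠ 0 → BondTouches (blockZd L v.1.1 v.1.2) z μ) →
      ∀ (μ : Fin d) (p : Site d × Site d), p ∈ AdmPair x.i.η len →
        hquot x.i.η β len U.1 (fun z => cutMulZd (ζ u) (Θ J) z μ) p ≤ B * a u * Real.exp (-(δ₀ * distZd L x u v)) * supNormZd J)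
    {P : Site d × Fin d → Prop} (π : {b : Site d × Fin d // P b} → BSite L x)
    (hπ' : ∀ b, BondTouches (blockZd L (π b).1.1 (π b).1.2) b.1.1 b.1.2)
    {κ₂ R S : ℝ} (hR : 0 ≤ R) {ω ω' : BSite L x → ℝ} (hω : ∀ v, 0 < ω v) (hω' : ∀ u, 0 ≤ ω' u)
    (hex : ∀ u v : BSite L x, ω' u * a u ≤ R * Real.exp (κ₂ * distZd L x u v) * ω v)
    (hS : ∀ u : BSite L x, ∑ v, Real.exp (-((δ₀ - κ₂) * distZd L x u v)) ≤ S)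
    (f : {b : Site d × Fin d // P b} → 𝔸) {M : ℝ} (hM : 0 ≤ M) (hMf : ∀ y, ω (π y) * ‖f y‖ ≤ M)
    (u : BSite L x) (μ : Fin d) {p : Site d × Site d} (hp : p ∈ AdmPair x.i.η len) :
    ω' u * hquot x.i.η β len U.1 (fun z => cutMulZd (ζ u) (Θ (extZd P f)) z μ) p ≤ B * R * S * M := by
  have hη : 0 < x.i.η := x.i.hη
  have hΘ0 : Θ (0 : Site d → Fin d → 𝔸) = 0 := by
    have h1 := hΘ 1 (0 : Site d → Fin d → 𝔸) 0
    rw [one_smul, one_smul, add_zero] at h1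
    have : Θ 0 + Θ 0 = Θ 0 + 0 := by rw [add_zero]; exact h1.symm
    exact add_left_cancel this
  have hS0 : 0 ≤ S := (Finset.sum_nonneg fun v _ => Real.exp_nonneg _).trans (hS u)
  rcases isEmpty_or_nonempty {b : Site d × Fin d // P b} with hP | hP
  · have hext : extZd P f = 0 := by
      funext z ν
      by_cases h : P (z, ν)
      · exact (hP.false ⟨(z, ν), h⟩).elim
      · exact extZd_apply_of_not f h
    have hq : hquot x.i.η β len U.1 (fun z => cutMulZd (ζ u) (Θ (extZd P f)) z μ) p = 0 := by
      rw [hext, hΘ0]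
      simp only [cutMulZd, Pi.zero_apply, smul_zero]
      exact hquot_zero_fun _ _ _ _ _
    rw [hq, mul_zero]
    exact mul_nonneg (mul_nonneg (mul_nonneg hB hR) hS0) hM
  let Φ : ({b : Site d × Fin d // P b} → 𝔸) → BSite L x → Fin d → Site d → 𝔸 :=
    fun g u' μ' z => cutMulZd (ζ u') (Θ (extZd P g)) z μ'
  have hΦ : ∀ (c : ℝ) (g g' : {b : Site d × Fin d // P b} → 𝔸) (u' : BSite L x) (μ' : Fin d) (z : Site d),
      Φ (c • g + g') u' μ' z = c • Φ g u' μ' z + Φ g' u' μ' z := by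
    intro c g g' u' μ' z
    simp only [Φ]
    rw [extZd_add, extZd_smul, hΘ, cutMulZd_linear]
    rfl
  let T : ({b : Site d × Fin d // P b} → 𝔸) →ₗ[ℝ] (BSite L x × Fin d × AdmPair x.i.η len → 𝔸) :=
    { toFun := fun g q => ((x.i.η * len (q.2.2.1.2 - q.2.2.1.1)) ^ β)⁻¹ •
        (B9Eq340HolderZd.trans U.1 q.2.2.1.1 q.2.2.1.2 (Φ g q.1 q.2.1 q.2.2.1.2) - Φ g q.1 q.2.1 q.2.2.1.1)
      map_add' := fun g g' => by
        funext q
        have h := hΦ 1 g g' q.1 q.2.1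
        simp only [one_smul] at h
        simp only [Pi.add_apply, h, trans_add, smul_add, smul_sub]
        abel
      map_smul' := fun c g => by
        funext q
        have h := hΦ c g 0 q.1 q.2.1
        have h0 : ∀ z, Φ 0 q.1 q.2.1 z = 0 := fun z => by
          simp only [Φ]
          have he : extZd P (0 : {b : Site d × Fin d // P b} → 𝔸) = 0 := by
            have := extZd_smul P (0 : ℝ) (0 : {b : Site d × Fin d // P b} → 𝔸)
            simpa using this
          rw [he, hΘ0]
          simp [cutMulZd]
        simp only [add_zero, h0] at h
        simp only [Pi.smul_apply, RingHom.id_apply, h, B9Eq340HolderZd.trans_smul, ← smul_sub, smul_comm c] }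
  have hT : ∀ (g : {b : Site d × Fin d // P b} → 𝔸) (q : BSite L x × Fin d × AdmPair x.i.η len),
      ‖T g q‖ = hquot x.i.η β len U.1 (fun z => cutMulZd (ζ q.1) (Θ (extZd P g)) z q.2.1) q.2.2.1 := by
    intro g q
    rw [hquot_eq_norm_smul hη U.1 _ q.2.2.2]
    rfl
  have hloc' : ∀ (v : BSite L x) (g : {b : Site d × Fin d // P b} → 𝔸) (F : ℝ), (∀ y, π y ≠ v → g y = 0) → (∀ y, ‖g y‖ ≤ F) →
      ∀ q : BSite L x × Fin d × AdmPair x.i.η len,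
        ‖T g q‖ ≤ B * a q.1 * Real.exp (-(δ₀ * distZd L x q.1 v)) * F := by
    intro v g F hgv hgF q
    obtain ⟨b₀⟩ := hP
    have hF0 : 0 ≤ F := (norm_nonneg _).trans (hgF b₀)
    have hsupp : ∀ (z : Site d) (ν : Fin d), extZd P g z ν ≠ 0 → BondTouches (blockZd L v.1.1 v.1.2) z ν := by
      intro z ν hne
      classical
      by_cases hPz : P (z, ν)
      · have hy : π ⟨(z, ν), hPz⟩ = v := by
          by_contra hne'
          exact hne (by rw [show extZd P g z ν = g ⟨(z, ν), hPz⟩ from extZd_apply_of g ⟨(z, ν), hPz⟩, hgv _ hne'])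
        have hmem := hπ' ⟨(z, ν), hPz⟩
        rw [hy] at hmem
        exact hmem
      · exact absurd (extZd_apply_of_not g hPz) hne
    have h3 : supNormZd (extZd P g) ≤ F := by
      refine supNormZd_le_of_forall hF0 fun z ν => ?_
      classical
      by_cases hPz : P (z, ν)
      · rw [show extZd P g z ν = g ⟨(z, ν), hPz⟩ from extZd_apply_of g ⟨(z, ν), hPz⟩]; exact hgF _
      · rw [extZd_apply_of_not g hPz, norm_zero]; exact hF0
    have h1 := hloc q.1 v (extZd P g) hsupp q.2.1 q.2.2.1 q.2.2.2
    have h4 : 0 ≤ B * a q.1 * Real.exp (-(δ₀ * distZd L x q.1 v)) := mul_nonneg (mul_nonneg hB (ha q.1)) (Real.exp_nonneg _)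
    rw [hT]
    calc hquot x.i.η β len U.1 (fun z => cutMulZd (ζ q.1) (Θ (extZd P g)) z q.2.1) q.2.2.1
        ≤ B * a q.1 * Real.exp (-(δ₀ * distZd L x q.1 v)) * supNormZd (extZd P g) := h1
      _ ≤ B * a q.1 * Real.exp (-(δ₀ * distZd L x q.1 v)) * F := mul_le_mul_of_nonneg_left h3 h4
  have h := weight_mul_norm_apply_le_of_local π (fun q : BSite L x × Fin d × AdmPair x.i.η len => q.1) (distZd L x) T
    (κ := δ₀) (κ₂ := κ₂) (a := a) hB hR hω hω' hloc' hex hS f hM hMf (u, μ, ⟨p, hp⟩)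
  rw [hT] at h
  exact h

variable [Nontrivial 𝔸]

/-- **INTENT-1's near-pair bound with touch-assignment**: (3.43) at the genuine readings summed, cut-off `1` at both points.
[cite: Balaban1985BackgroundPropagators, (3.43) p.398, (3.40) p.397, Thm 3.3 p.399; Balaban1985RegularSpaces, Prop. 3 p.87, (1.36) p.82; Balaban1984PropagatorsII, Lemma 2.1 p.234] -/
theorem weight_mul_hquot_gradGop_le_of_ineq343' {x : MemberZd d L} [Fintype (BSite L x)] {ops : OpsZd d 𝔸} {U : CfgZd d 𝔸}
    {Bβ Bε : ℝ → ℝ} {Bεβ : ℝ → ℝ → ℝ} {δ₀ β : ℝ} (h345 : B9.Ineq343_345 (GAZdOfOps 𝔸 L len x ops) Bβ Bε Bεβ δ₀ U)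
    (hβ0 : 0 ≤ β) (hβ1 : β < 1) (hlen : ∀ v : Site d, 0 < len v → 1 ≤ len v)
    (hlin : ∀ (c : ℝ) (A B : Site d → Fin d → 𝔸), ops.Gop U.1 (c • A + B) = c • ops.Gop U.1 A + ops.Gop U.1 B)
    (ζ : BSite L x → Site d → ℝ) (hζ : ∀ (u : BSite L x) (z : Site d), ζ u z ≠ 0 → z ∈ blockTZd L u.1.1 u.1.2)
    {P : Site d × Fin d → Prop} (π : {b : Site d × Fin d // P b} → BSite L x)
    (hπ' : ∀ b, BondTouches (blockZd L (π b).1.1 (π b).1.2) b.1.1 b.1.2)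
    {κ₂ R S : ℝ} (hR : 0 ≤ R) {ω ω' : BSite L x → ℝ} (hω : ∀ v, 0 < ω v) (hω' : ∀ u, 0 ≤ ω' u)
    (hex : ∀ u v : BSite L x,
      ω' u * (((L : ℝ) ^ u.1.1 * x.i.η) ^ (1 - β) * cutHZd x.i.η β len (ζ u)) ≤ R * Real.exp (κ₂ * distZd L x u v) * ω v)
    (hS : ∀ u : BSite L x, ∑ v, Real.exp (-((δ₀ - κ₂) * distZd L x u v)) ≤ S)
    (ν : Fin d) (f : {b : Site d × Fin d // P b} → 𝔸) {M : ℝ} (hM : 0 ≤ M) (hMf : ∀ y, ω (π y) * ‖f y‖ ≤ M)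
    (u : BSite L x) (μ : Fin d) {p : Site d × Site d} (hp : p ∈ AdmPair x.i.η len) (h1 : ζ u p.1 = 1) (h2 : ζ u p.2 = 1) :
    ω' u * hquot x.i.η β len U.1 (covDerivFwd x.i.η U.1 ν (fun z => ops.Gop U.1 (extZd P f) z μ)) p ≤ max 0 (Bβ β) * R * S * M := by
  have h := weight_mul_hquot_cut_le_of_local' U β (fun J => cdBZd x.i.η U.1 ν (ops.Gop U.1 J)) (comp_linear (cdBZd_linear x.i.η U.1 ν) hlin) ζ
    (le_max_left 0 (Bβ β)) (blockFactor_nonneg x β ζ)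
    (fun u' v J hJ μ' p' hp' => locHolder_grad_of_ineq343 h345 hβ0 hβ1 hlen ζ hζ ν u' v J hJ μ' p' hp')
    π hπ' hR hω hω' hex hS f hM hMf u μ hp
  rw [hquot_cutMulZd_of_eq_one U.1 (ζ u) _ μ h1 h2] at h
  exact h

end Touch

/-! ## §2 The both-points bound with the touch-assigned source class -/

section Both

variable {𝔸 : Type} [CStarAlgebra 𝔸] [Nontrivial 𝔸] {L : ℕ} {len : Site d → ℝ}

-- budget line: two long instantiations + case split; elaborates inside the default today, margin for Mathlib drift
set_option maxHeartbeats 400000 in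
/-- ★★ **THE REPAIRED HÖLDER LINE, POINTWISE, TOUCH-ASSIGNED SOURCES**: `B9Eq343HolderBothZdFinite.weight_mul_hquot_gradGop_le_both` with the source class assigned
to blocks the bonds TOUCH (`hπ'`), and base-assignment kept only for the bonds based at a site of some `Ω_j` (`hπbase`) — these carry the output points.
[cite: Balaban1985RegularSpaces, (1.36) p.82, (1.59) p.86, (1.62) + Prop. 3 p.87; Balaban1985BackgroundPropagators, (3.42) p.397, (3.43) + (3.47) p.398, Thm 3.3 p.399; Balaban1984PropagatorsII, Lemma 2.1 (2.60)–(2.61) p.234] -/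
theorem weight_mul_hquot_gradGop_le_both' {x : MemberZd d L} [Fintype (BSite L x)] (hL : 1 ≤ L) {ops : OpsZd d 𝔸} {U : CfgZd d 𝔸}
    {B₀ δ₀ β : ℝ} {Bβ Bε : ℝ → ℝ} {Bεβ : ℝ → ℝ → ℝ} (hB₀ : 0 ≤ B₀)
    (h342 : B9.Ineq342_346_347 (GAZdOfOps 𝔸 L len x ops) B₀ δ₀ U) (h345 : B9.Ineq343_345 (GAZdOfOps 𝔸 L len x ops) Bβ Bε Bεβ δ₀ U)
    (hβ0 : 0 ≤ β) (hβ1 : β < 1) (hlen1 : ∀ v : Site d, 0 < len v → 1 ≤ len v)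
    (hlen : ∀ z z' : Site d, (linfDist z z' : ℝ) ≤ len (z' - z))
    (hlin : ∀ (c : ℝ) (A B : Site d → Fin d → 𝔸), ops.Gop U.1 (c • A + B) = c • ops.Gop U.1 A + ops.Gop U.1 B)
    {P : Site d × Fin d → Prop} (π : {b : Site d × Fin d // P b} → BSite L x)
    (hπ' : ∀ b, BondTouches (blockZd L (π b).1.1 (π b).1.2) b.1.1 b.1.2)
    (hπbase : ∀ (b : {b : Site d × Fin d // P b}) (j : ℕ), j ≤ x.m → b.1.1 ∈ x.i.Ω j → b.1.1 ∈ blockZd L (π b).1.1 (π b).1.2)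
    (hPΩ : ∀ j, j ≤ x.m → ∀ (z : Site d) (μ : Fin d), z ∈ x.i.Ω j → P (z, μ))
    (hlev : ∀ (b : {b : Site d × Fin d // P b}) (j : ℕ), j ≤ x.m → b.1.1 ∈ x.i.Ω j → j ≤ (π b).1.1)
    {κ₂ R R₁ S : ℝ} (hR : 0 ≤ R) (hR₁ : 0 ≤ R₁) {ω : BSite L x → ℝ} (hω : ∀ v, 0 < ω v)
    (hexH : ∀ u v : BSite L x, ((L : ℝ) ^ u.1.1 * x.i.η) ^ (2 + β) *
      (((L : ℝ) ^ u.1.1 * x.i.η) ^ (1 - β) * cutHZd x.i.η β len (zetaZd L u.1.1 u.1.2)) ≤ R * Real.exp (κ₂ * distZd L x u v) * ω v)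
    (hex1 : ∀ u v : BSite L x, ((L : ℝ) ^ u.1.1 * x.i.η) ^ 2 * ((L : ℝ) ^ u.1.1 * x.i.η) ≤ R₁ * Real.exp (κ₂ * distZd L x u v) * ω v)
    (hS : ∀ u : BSite L x, ∑ v, Real.exp (-((δ₀ - κ₂) * distZd L x u v)) ≤ S)
    (ν : Fin d) (f : {b : Site d × Fin d // P b} → 𝔸) {M : ℝ} (hM : 0 ≤ M) (hMf : ∀ y, ω (π y) * ‖f y‖ ≤ M)
    {j : ℕ} (hj : j ≤ x.m) (μ : Fin d) {p : Site d × Site d} (hp : p ∈ AdmPair x.i.η len) (hxΩ : p.1 ∈ x.i.Ω j) (hx'Ω : p.2 ∈ x.i.Ω j) :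
    weight L x.i.η (-(2 + β)) j * hquot x.i.η β len U.1 (covDerivFwd x.i.η U.1 ν (fun z => ops.Gop U.1 (extZd P f) z μ)) p ≤
      (max 0 (Bβ β) * R * S + 2 * (4 : ℝ) ^ β * (B₀ * R₁ * S)) * M := by
  have hη : 0 < x.i.η := x.i.hη
  set b : {b : Site d × Fin d // P b} := ⟨(p.1, μ), hPΩ j hj p.1 μ hxΩ⟩ with hb
  have hS0 : 0 ≤ S := (Finset.sum_nonneg fun v _ => Real.exp_nonneg _).trans (hS (π b))
  have hju : j ≤ (π b).1.1 := hlev b j hj hxΩ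
  have hxblk : p.1 ∈ blockZd L (π b).1.1 (π b).1.2 := hπbase b j hj hxΩ
  have hq0 : 0 ≤ hquot x.i.η β len U.1 (covDerivFwd x.i.η U.1 ν (fun z => ops.Gop U.1 (extZd P f) z μ)) p := hquot_nonneg hη.le β U.1 _ hp
  have hnear0 : 0 ≤ max 0 (Bβ β) * R * S * M := by positivity
  have hfar0 : 0 ≤ 2 * (4 : ℝ) ^ β * (B₀ * R₁ * S) * M := by positivity
  by_cases hcore : p.2 ∈ coreZd L (π b).1.1 (π b).1.2
  · have h1 : zetaZd L (π b).1.1 (π b).1.2 p.1 = 1 := zetaZd_eq_one_of_mem_blockZd hxblk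
    have h2 : zetaZd L (π b).1.1 (π b).1.2 p.2 = 1 := zetaZd_eq_one_of_mem_coreZd hcore
    have hnear := weight_mul_hquot_gradGop_le_of_ineq343' (len := len) h345 hβ0 hβ1 hlen1 hlin (fun u => zetaZd L u.1.1 u.1.2)
      (fun u z hz => mem_blockTZd_of_zetaZd_ne_zero hz) π hπ' hR hω
      (fun u => Real.rpow_nonneg (B8ScaledSupNorm.scale_pos hL hη u.1.1).le _) hexH hS ν f hM hMf (π b) μ hp h1 h2
    have hw : weight L x.i.η (-(2 + β)) j ≤ ((L : ℝ) ^ (π b).1.1 * x.i.η) ^ (2 + β) := weight_holder_le hL hη hβ0 hju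
    calc weight L x.i.η (-(2 + β)) j * hquot x.i.η β len U.1 (covDerivFwd x.i.η U.1 ν (fun z => ops.Gop U.1 (extZd P f) z μ)) p
        ≤ ((L : ℝ) ^ (π b).1.1 * x.i.η) ^ (2 + β) * hquot x.i.η β len U.1 (covDerivFwd x.i.η U.1 ν (fun z => ops.Gop U.1 (extZd P f) z μ)) p :=
          mul_le_mul_of_nonneg_right hw hq0
      _ ≤ max 0 (Bβ β) * R * S * M := hnear
      _ ≤ (max 0 (Bβ β) * R * S + 2 * (4 : ℝ) ^ β * (B₀ * R₁ * S)) * M := by nlinarith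
  · have hfarlen : (1 / 4 : ℝ) * ((L : ℝ) ^ j * x.i.η) ≤ x.i.η * len (p.2 - p.1) :=
      le_trans (mul_le_mul_of_nonneg_left (scale_mono hL hη.le hju) (by norm_num)) (quarter_scale_le_len hη.le hlen hxblk hcore)
    have hfar := weight_mul_hquot_le_of_far (len := len) hL U hβ0 (covDerivFwd x.i.η U.1 ν (fun z => ops.Gop U.1 (extZd P f) z μ)) hp j
      (by norm_num : (0 : ℝ) < 1 / 4) hfarlen
    have hend : ∀ (z : Site d) (hzΩ : z ∈ x.i.Ω j),
        weight L x.i.η (-(2 : ℝ)) j * ‖covDerivFwd x.i.η U.1 ν (fun w => ops.Gop U.1 (extZd P f) w μ) z‖ ≤ B₀ * R₁ * S * M := by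
      intro z hzΩ
      have hz : P (z, μ) := hPΩ j hj z μ hzΩ
      have hjz : j ≤ (π ⟨(z, μ), hz⟩).1.1 := hlev ⟨(z, μ), hz⟩ j hj hzΩ
      have hg0 := weight_mul_norm_gradGop_le_of_ineq342' (len := len) hB₀ h342 hlin π hπ' hR₁ hω
        (fun u => pow_nonneg (B8ScaledSupNorm.scale_pos hL hη u.1.1).le 2) hex1 hS ν f hM hMf ⟨(z, μ), hz⟩
      have hw2 : weight L x.i.η (-(2 : ℝ)) j ≤ ((L : ℝ) ^ (π ⟨(z, μ), hz⟩).1.1 * x.i.η) ^ 2 := weight_two_le hL hη hjz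
      exact (mul_le_mul_of_nonneg_right hw2 (norm_nonneg _)).trans hg0
    have he1 := hend p.1 hxΩ
    have he2 := hend p.2 hx'Ω
    have h4 : ((1 / 4 : ℝ)) ^ (-β) = (4 : ℝ) ^ β := by
      rw [Real.rpow_neg (by norm_num), one_div, Real.inv_rpow (by norm_num), inv_inv]
    rw [h4] at hfar
    have h4β : 0 ≤ (4 : ℝ) ^ β := Real.rpow_nonneg (by norm_num) β
    calc weight L x.i.η (-(2 + β)) j * hquot x.i.η β len U.1 (covDerivFwd x.i.η U.1 ν (fun z => ops.Gop U.1 (extZd P f) z μ)) p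
        ≤ (4 : ℝ) ^ β * (weight L x.i.η (-(2 : ℝ)) j * ‖covDerivFwd x.i.η U.1 ν (fun z => ops.Gop U.1 (extZd P f) z μ) p.1‖ +
            weight L x.i.η (-(2 : ℝ)) j * ‖covDerivFwd x.i.η U.1 ν (fun z => ops.Gop U.1 (extZd P f) z μ) p.2‖) := hfar
      _ ≤ (4 : ℝ) ^ β * (B₀ * R₁ * S * M + B₀ * R₁ * S * M) := mul_le_mul_of_nonneg_left (add_le_add he1 he2) h4β
      _ = 2 * (4 : ℝ) ^ β * (B₀ * R₁ * S) * M := by ring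
      _ ≤ (max 0 (Bβ β) * R * S + 2 * (4 : ℝ) ^ β * (B₀ * R₁ * S)) * M := by nlinarith

/-- ★★ the msup form in the binder owner's constant shape, touch-assigned sources. [cite: Balaban1985RegularSpaces, (1.36) p.82, (1.59) p.86, Prop. 3 p.87; Balaban1985BackgroundPropagators, Thm 3.3 p.399, (3.42)–(3.43) pp.397–398; Balaban1984PropagatorsII, Lemma 2.1 p.234] -/
theorem holderBoth_msup_le_CH' {x : MemberZd d L} [Fintype (BSite L x)] (hL : 1 ≤ L) {ops : OpsZd d 𝔸} {U : CfgZd d 𝔸}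
    {B₀ δ₀ β : ℝ} {Bβ Bε : ℝ → ℝ} {Bεβ : ℝ → ℝ → ℝ} (hB₀ : 0 ≤ B₀)
    (h342 : B9.Ineq342_346_347 (GAZdOfOps 𝔸 L len x ops) B₀ δ₀ U) (h345 : B9.Ineq343_345 (GAZdOfOps 𝔸 L len x ops) Bβ Bε Bεβ δ₀ U)
    (hβ0 : 0 ≤ β) (hβ1 : β < 1) (hlen1 : ∀ v : Site d, 0 < len v → 1 ≤ len v)
    (hlen : ∀ z z' : Site d, (linfDist z z' : ℝ) ≤ len (z' - z))
    (hlin : ∀ (c : ℝ) (A B : Site d → Fin d → 𝔸), ops.Gop U.1 (c • A + B) = c • ops.Gop U.1 A + ops.Gop U.1 B)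
    {P : Site d × Fin d → Prop} (π : {b : Site d × Fin d // P b} → BSite L x)
    (hπ' : ∀ b, BondTouches (blockZd L (π b).1.1 (π b).1.2) b.1.1 b.1.2)
    (hπbase : ∀ (b : {b : Site d × Fin d // P b}) (j : ℕ), j ≤ x.m → b.1.1 ∈ x.i.Ω j → b.1.1 ∈ blockZd L (π b).1.1 (π b).1.2)
    (hPΩ : ∀ j, j ≤ x.m → ∀ (z : Site d) (μ : Fin d), z ∈ x.i.Ω j → P (z, μ))
    (hlev : ∀ (b : {b : Site d × Fin d // P b}) (j : ℕ), j ≤ x.m → b.1.1 ∈ x.i.Ω j → j ≤ (π b).1.1)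
    {κ₂ R R₁ S : ℝ} (hR : 0 ≤ R) (hR₁ : 0 ≤ R₁) {ω : BSite L x → ℝ} (hω : ∀ v, 0 < ω v)
    (hexH : ∀ u v : BSite L x, ((L : ℝ) ^ u.1.1 * x.i.η) ^ (2 + β) *
      (((L : ℝ) ^ u.1.1 * x.i.η) ^ (1 - β) * cutHZd x.i.η β len (zetaZd L u.1.1 u.1.2)) ≤ R * Real.exp (κ₂ * distZd L x u v) * ω v)
    (hex1 : ∀ u v : BSite L x, ((L : ℝ) ^ u.1.1 * x.i.η) ^ 2 * ((L : ℝ) ^ u.1.1 * x.i.η) ≤ R₁ * Real.exp (κ₂ * distZd L x u v) * ω v)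
    (hS : ∀ u : BSite L x, ∑ v, Real.exp (-((δ₀ - κ₂) * distZd L x u v)) ≤ S)
    (hS0 : 0 ≤ S) (f : {b : Site d × Fin d // P b} → 𝔸) {M : ℝ} (hM : 0 ≤ M) (hMf : ∀ y, ω (π y) * ‖f y‖ ≤ M) :
    msup L x.m x.i.η (-(2 + β))
        (fun j (q : Fin d × Fin d × (Site d × Site d)) => q.2.2 ∈ AdmPair x.i.η len ∧ q.2.2.1 ∈ x.i.Ω j ∧ q.2.2.2 ∈ x.i.Ω j)
        (fun q => hquot x.i.η β len U.1 (covDerivFwd x.i.η U.1 q.1 (fun z => ops.Gop U.1 (extZd P f) z q.2.1)) q.2.2) ≤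
      max (R * S) (2 * (4 : ℝ) ^ β * R₁ * S) * (B₀ + max 0 (Bβ β)) * M := by
  have hη : 0 < x.i.η := x.i.hη
  have hC : 0 ≤ max (R * S) (2 * (4 : ℝ) ^ β * R₁ * S) * (B₀ + max 0 (Bβ β)) * M := by
    have : 0 ≤ max (R * S) (2 * (4 : ℝ) ^ β * R₁ * S) := le_max_of_le_left (mul_nonneg hR hS0)
    positivity
  refine B8ScaledSupNorm.msup_le hC fun j hj q hq => ?_
  obtain ⟨hp, hxΩ, hx'Ω⟩ := hq
  rw [Real.norm_of_nonneg (hquot_nonneg hη.le β U.1 _ hp)]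
  have h := weight_mul_hquot_gradGop_le_both' hL hB₀ h342 h345 hβ0 hβ1 hlen1 hlen hlin π hπ' hπbase hPΩ hlev hR hR₁ hω hexH hex1 hS q.1 f hM hMf hj
    q.2.1 hp hxΩ hx'Ω
  refine h.trans ?_
  have ha : 0 ≤ max 0 (Bβ β) := le_max_left _ _
  have h1 : max 0 (Bβ β) * R * S ≤ max (R * S) (2 * (4 : ℝ) ^ β * R₁ * S) * max 0 (Bβ β) := by
    calc max 0 (Bβ β) * R * S = (R * S) * max 0 (Bβ β) := by ring
      _ ≤ max (R * S) (2 * (4 : ℝ) ^ β * R₁ * S) * max 0 (Bβ β) := mul_le_mul_of_nonneg_right (le_max_left _ _) ha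
  have h2 : 2 * (4 : ℝ) ^ β * (B₀ * R₁ * S) ≤ max (R * S) (2 * (4 : ℝ) ^ β * R₁ * S) * B₀ := by
    calc 2 * (4 : ℝ) ^ β * (B₀ * R₁ * S) = (2 * (4 : ℝ) ^ β * R₁ * S) * B₀ := by ring
      _ ≤ max (R * S) (2 * (4 : ℝ) ^ β * R₁ * S) * B₀ := mul_le_mul_of_nonneg_right (le_max_right _ _) hB₀
  have h3 : max 0 (Bβ β) * R * S + 2 * (4 : ℝ) ^ β * (B₀ * R₁ * S) ≤ max (R * S) (2 * (4 : ℝ) ^ β * R₁ * S) * (B₀ + max 0 (Bβ β)) := by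
    nlinarith
  exact mul_le_mul_of_nonneg_right h3 hM

end Both

/-! ## §3 Plumbing: restriction = extension by zero; bounded `(−3)`-families on finite members; `0 ≤ B₀` from a bump -/

section Plumbing

variable {𝔸 : Type} [CStarAlgebra 𝔸] {L : ℕ} {len : Site d → ℝ}

/-- **`𝟙_{Ω₀-bonds}J` IS the extension by zero of `J` restricted to the bonds touching `Ω₀`.** [cite: Balaban1985BackgroundPropagators, (3.27) p.395 («restricted to Ω₀»); Balaban1985RegularSpaces, p.77 (bond convention)] -/
theorem restrictDom_eq_extZd (Ω₀ : Set (Site d)) (J : Site d → Fin d → 𝔸) :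
    restrictDom Ω₀ J = extZd (fun b : Site d × Fin d => BondTouches Ω₀ b.1 b.2) (fun b => J b.1.1 b.1.2) := by
  classical
  funext z μ
  by_cases h : BondTouches Ω₀ z μ
  · rw [extZd_apply_of (P := fun b : Site d × Fin d => BondTouches Ω₀ b.1 b.2) (fun b => J b.1.1 b.1.2) ⟨(z, μ), h⟩]
    simp [restrictDom, h]
  · rw [extZd_apply_of_not _ h]
    simp [restrictDom, h]

/-- **on a finite member every bond field has a bounded `(−3)`-family** (finitely many bonds touch `Ω₀ ⊇ Ω_j`). [cite: Balaban1985RegularSpaces, p.86 (|·|₍₋₃₎; bookkeeping)] -/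
theorem bdd_neg_three_of_finite {m : ℕ} (i : ZdIdx d L) (hΩ : (i.Ω 0).Finite) (J : Site d → Fin d → 𝔸) :
    Bdd L m i.η (-(3 : ℝ)) (fun j (b : Site d × Fin d) => BondTouches (i.Ω j) b.1 b.2) (fun b => J b.1 b.2) := by
  classical
  have hfinI : ({p : ℕ × (Site d × Fin d) | p.1 ≤ m ∧ BondTouches (i.Ω p.1) p.2.1 p.2.2}).Finite := by
    refine ((Set.finite_Iic m).prod (finite_bondTouches hΩ)).subset ?_
    rintro ⟨j, b⟩ ⟨hj, hb⟩
    exact ⟨hj, hb.imp (fun h => Omega_antitone i (Nat.zero_le j) h) (fun h => Omega_antitone i (Nat.zero_le j) h)⟩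
  obtain ⟨c, hc⟩ := (hfinI.image fun p => weight L i.η (-(3 : ℝ)) p.1 * ‖J p.2.1 p.2.2‖).bddAbove
  exact ⟨c, fun j hj b hb => hc ⟨(j, b), ⟨hj, hb⟩, rfl⟩⟩

variable [Nontrivial 𝔸]

/-- **the (3.42) reading at a one-bond bump pins `0 ≤ B₀`**: if some block `Δ(y)` contains a site `z` and a direction `μ` exists, the bond field equal to `1` at
`⟨z, z + e_μ⟩` and `0` elsewhere is supported on the bonds of `Δ(y)` with `|J| ≥ 1`, and the n = 0 entry `0 ≤ e₀ ≤ B₀·(Lʲη)²·|J|` forces `0 ≤ B₀`.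
[cite: Balaban1985BackgroundPropagators, (3.42) p.397 (bookkeeping)] -/
theorem B0_nonneg_of_ineq342_zd (hL : 1 ≤ L) {x : MemberZd d L} {ops : OpsZd d 𝔸} {U : CfgZd d 𝔸} {B₀ δ₀ : ℝ}
    (h342 : B9.Ineq342_346_347 (GAZdOfOps 𝔸 L len x ops) B₀ δ₀ U) (y : BSite L x) {z : Site d} (hz : z ∈ blockZd L y.1.1 y.1.2) (μ : Fin d) :
    0 ≤ B₀ := by
  classical
  let J : Site d → Fin d → 𝔸 := fun z' μ' => if z' = z ∧ μ' = μ then 1 else 0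
  have hJsupp : ∀ (z' : Site d) (μ' : Fin d), J z' μ' ≠ 0 → BondTouches (blockZd L y.1.1 y.1.2) z' μ' := by
    intro z' μ' hne
    by_cases h : z' = z ∧ μ' = μ
    · rw [h.1]; exact Or.inl hz
    · exact absurd (by simp [J, h]) hne
  have h1 := ineq342_of_GAZdOfOps (𝔸 := 𝔸) (L := L) (len := len) h342 0 J y y hJsupp
  have he0 : 0 ≤ eOfOps 𝔸 L ops x 0 U J y := B9SupplySockB9P3ZdLocalLettersOfOps.eOfOps_nonneg (𝔸 := 𝔸) (L := L) ops x 0 U J y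
  have hbdd : BddAbove (Set.range fun b : Site d × Fin d => ‖J b.1 b.2‖) := by
    refine ⟨1, ?_⟩
    rintro _ ⟨b, rfl⟩
    by_cases h : b.1 = z ∧ b.2 = μ <;> simp [J, h]
  have hsup : 1 ≤ supNormZd J := by
    have h := le_ciSup hbdd (z, μ)
    simp only [J, and_self, if_true, norm_one] at h
    exact h
  have hpref : 0 < B9.pref4 ((L : ℝ) ^ y.1.1 * x.i.η) 0 := by
    have := B8ScaledSupNorm.scale_pos hL x.i.hη y.1.1
    simp [B9.pref4]; positivity
  rw [B9SupplySockB9P3ZdFrame.distZd_self, mul_zero, neg_zero, Real.exp_zero, mul_one] at h1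
  by_contra hB
  have hB' : B₀ < 0 := not_le.mp hB
  have : B₀ * B9.pref4 ((L : ℝ) ^ y.1.1 * x.i.η) 0 * supNormZd J < 0 := by
    have h2 : B₀ * B9.pref4 ((L : ℝ) ^ y.1.1 * x.i.η) 0 < 0 := mul_neg_of_neg_of_pos hB' hpref
    exact mul_neg_of_neg_of_pos h2 (lt_of_lt_of_le zero_lt_one hsup)
  linarith

end Plumbing

/-! ## §4 The discharge of `HolderAtδ2` at the frame on a finite member -/

section Discharge

variable {𝔸 : Type} [CStarAlgebra 𝔸] [Nontrivial 𝔸] {L : ℕ}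

-- budget line: the binder unfolds to an 11-binder statement and the proof instantiates two long summation theorems; inside the default today
set_option maxHeartbeats 400000 in
/-- ★★★ **`HolderAtδ2` IS A THEOREM ON EVERY FINITE MEMBER** (dag-n06-b EDITION δ₂, p598001) — at the `ℤᵈ` frame `geoZd ∕ bgZd ∕ GAZdFamOfOps ∕ memZd ∕ ιCfgZd`, for
EVERY letter record `ops` whose `G(U₀)` at the member is ℝ-linear and reads `J` on the bonds of `Ω₀` only (`hrestrict` — dag-n06-w4's `gopZd` is built that way),
on a member with finitely many blocks (non-empty `𝔅`), finite `Ω₀`, `1 ≤ L`, `0 ≤ β < 1`, a length function with `1 ≤ len` and `|·|_∞ ≤ len` (`l1Len`), and the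
block laws (T) «level-j block ⊆ Ω_j», (G1′) «every site of every Ω_j (j ≤ m) lies in a block», (G2′) «a level-j_y block meets Ω_j only for j ≤ j_y»: the binder
holds with the member's constant `CH := fun _ => max (R_H·|𝔅|) (2·4^β·R₁·|𝔅|)` (the Lemma-2.1 letters at `κ₂ := 0`, `exchangeLetter_of_fintype` ∕ `rowLetter_of_fintype`).
Proof: the source class = bonds touching `Ω₀`, assigned to a block they TOUCH (base's block when the base is a site of `Ω₀`, else the tip's), `J ↦ 𝟙_{Ω₀-bonds}J =
extZd` (`hrestrict`), `holderBoth_msup_le_CH'`, `M := |J|₍₋₃₎` (bounded family: finitely many bonds), `0 ≤ B₀` from the bump (or everything vanishes).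
[cite: Balaban1985RegularSpaces, (1.36) p.82, (1.59) p.86, (1.62) + Prop. 3 p.87; Balaban1985BackgroundPropagators, Thm 3.3 p.399, (3.42)–(3.43) pp.397–398; Balaban1984PropagatorsII, Lemma 2.1 p.234 (member constants)] -/
theorem holderAtδ2_zd_of_finite (hL : 1 ≤ L) {len : Site d → ℝ} (hlen1 : ∀ v : Site d, 0 < len v → 1 ≤ len v)
    (hlen : ∀ z z' : Site d, (linfDist z z' : ℝ) ≤ len (z' - z)) {β : ℝ} (hβ0 : 0 ≤ β) (hβ1 : β < 1)
    (ops : ℝ → ZdIdx d L → ℕ → OpsZd d 𝔸) (M : ℝ) (i : ZdIdx d L) (m : ℕ)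
    [Fintype (BSite L (memZd M i m))] [Nonempty (BSite L (memZd M i m))] (hΩfin : (i.Ω 0).Finite)
    (hT : ∀ y : BSite L (memZd M i m), blockZd L y.1.1 y.1.2 ⊆ i.Ω y.1.1)
    (hcover : ∀ j, j ≤ m → ∀ z : Site d, z ∈ i.Ω j → ∃ y : BSite L (memZd M i m), z ∈ blockZd L y.1.1 y.1.2)
    (hlevel : ∀ (y : BSite L (memZd M i m)) (z : Site d), z ∈ blockZd L y.1.1 y.1.2 → ∀ j, j ≤ m → z ∈ i.Ω j → j ≤ y.1.1)
    (hlin : ∀ (U₀ : Site d → Fin d → 𝔸ˣ) (c : ℝ) (A B : Site d → Fin d → 𝔸),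
      (ops M i m).Gop U₀ (c • A + B) = c • (ops M i m).Gop U₀ A + (ops M i m).Gop U₀ B)
    (hrestrict : ∀ (U₀ : Site d → Fin d → 𝔸ˣ) (J : Site d → Fin d → 𝔸), (ops M i m).Gop U₀ J = (ops M i m).Gop U₀ (restrictDom (i.Ω 0) J)) :
    HolderAtδ2 (geoZd 𝔸 L len) (bgZd 𝔸 L) (GAZdFamOfOps 𝔸 L len ops) L memZd (ιCfgZd 𝔸 L) ops β len
      (fun _ => max
        (((Finset.univ.sup' Finset.univ_nonempty fun u : BSite L (memZd M i m) =>
            ((L : ℝ) ^ u.1.1 * i.η) ^ (2 + β) * (((L : ℝ) ^ u.1.1 * i.η) ^ (1 - β) * cutHZd i.η β len (zetaZd L u.1.1 u.1.2))) *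
          (Finset.univ.sup' Finset.univ_nonempty fun v : BSite L (memZd M i m) => (((L : ℝ) ^ v.1.1 * i.η) ^ 3)⁻¹)) *
          (Fintype.card (BSite L (memZd M i m)) : ℝ))
        (2 * (4 : ℝ) ^ β *
          ((Finset.univ.sup' Finset.univ_nonempty fun u : BSite L (memZd M i m) => ((L : ℝ) ^ u.1.1 * i.η) ^ 2 * ((L : ℝ) ^ u.1.1 * i.η)) *
            (Finset.univ.sup' Finset.univ_nonempty fun v : BSite L (memZd M i m) => (((L : ℝ) ^ v.1.1 * i.η) ^ 3)⁻¹)) *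
          (Fintype.card (BSite L (memZd M i m)) : ℝ))) M i m := by
  classical
  intro Bβ Bε Bεβ δ₀ B₀ U₀ hU₀ hδ₀ h342 h345 J
  have hη : 0 < i.η := i.hη
  -- the readings are those of the record `ops M i m` at the member `x`
  change B9.Ineq342_346_347 (GAZdOfOps 𝔸 L len (memZd M i m) (ops M i m)) B₀ δ₀ (⟨U₀, hU₀⟩ : CfgZd d 𝔸) at h342
  change B9.Ineq343_345 (GAZdOfOps 𝔸 L len (memZd M i m) (ops M i m)) Bβ Bε Bεβ δ₀ (⟨U₀, hU₀⟩ : CfgZd d 𝔸) at h345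
  set U : CfgZd d 𝔸 := ⟨U₀, hU₀⟩ with hU
  -- the source class: bonds touching `Ω₀`; block assignment by choice (base's block if the base is a site of `Ω₀`, else the tip's)
  let P : Site d × Fin d → Prop := fun b => BondTouches (i.Ω 0) b.1 b.2
  have hπex : ∀ b : {b : Site d × Fin d // P b}, ∃ y : BSite L (memZd M i m), BondTouches (blockZd L y.1.1 y.1.2) b.1.1 b.1.2 ∧
      ((∃ y' : BSite L (memZd M i m), b.1.1 ∈ blockZd L y'.1.1 y'.1.2) → b.1.1 ∈ blockZd L y.1.1 y.1.2) := by
    intro b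
    by_cases hb : ∃ y' : BSite L (memZd M i m), b.1.1 ∈ blockZd L y'.1.1 y'.1.2
    · obtain ⟨y', hy'⟩ := hb
      exact ⟨y', Or.inl hy', fun _ => hy'⟩
    · rcases b.2 with h0 | h1
      · exact absurd (hcover 0 (Nat.zero_le _) _ h0) hb
      · obtain ⟨y, hy⟩ := hcover 0 (Nat.zero_le _) _ h1
        exact ⟨y, Or.inr hy, fun h => absurd h hb⟩
  choose π hπ' hπb using hπex
  have hπbase : ∀ (b : {b : Site d × Fin d // P b}) (j : ℕ), j ≤ m → b.1.1 ∈ i.Ω j → b.1.1 ∈ blockZd L (π b).1.1 (π b).1.2 :=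
    fun b j hj hz => hπb b (hcover j hj _ hz)
  have hPΩ : ∀ j, j ≤ m → ∀ (z : Site d) (μ : Fin d), z ∈ i.Ω j → P (z, μ) :=
    fun j _ z μ hz => Or.inl (Omega_antitone i (Nat.zero_le j) hz)
  have hlev : ∀ (b : {b : Site d × Fin d // P b}) (j : ℕ), j ≤ m → b.1.1 ∈ i.Ω j → j ≤ (π b).1.1 :=
    fun b j hj hz => hlevel (π b) b.1.1 (hπbase b j hj hz) j hj hz
  -- the source `f := J|P` and `G(U₀)J = G(U₀)f̃`
  let f : {b : Site d × Fin d // P b} → 𝔸 := fun b => J b.1.1 b.1.2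
  have hext : restrictDom (i.Ω 0) J = extZd P f := restrictDom_eq_extZd (i.Ω 0) J
  have hGJ : ∀ (z : Site d) (μ : Fin d), (ops M i m).Gop U₀ J z μ = (ops M i m).Gop U.1 (extZd P f) z μ := by
    intro z μ; rw [hrestrict U₀ J, hext]
  -- weights, member letters at `κ₂ := 0`
  let ω : BSite L (memZd M i m) → ℝ := fun v => ((L : ℝ) ^ v.1.1 * i.η) ^ 3
  have hω : ∀ v, 0 < ω v := fun v => pow_pos (B8ScaledSupNorm.scale_pos hL hη v.1.1) 3
  have haH : ∀ u : BSite L (memZd M i m), 0 ≤ ((L : ℝ) ^ u.1.1 * i.η) ^ (2 + β) *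
      (((L : ℝ) ^ u.1.1 * i.η) ^ (1 - β) * cutHZd i.η β len (zetaZd L u.1.1 u.1.2)) := fun u =>
    mul_nonneg (Real.rpow_nonneg (B8ScaledSupNorm.scale_pos hL hη u.1.1).le _)
      (blockFactor_nonneg (len := len) (memZd M i m) β (fun u => zetaZd L u.1.1 u.1.2) u)
  have ha1 : ∀ u : BSite L (memZd M i m), 0 ≤ ((L : ℝ) ^ u.1.1 * i.η) ^ 2 * ((L : ℝ) ^ u.1.1 * i.η) := fun u =>
    mul_nonneg (sq_nonneg _) (B8ScaledSupNorm.scale_pos hL hη u.1.1).le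
  -- `M := |J|₍₋₃₎` bounds the weighted source values
  have hBdd := bdd_neg_three_of_finite (L := L) (m := m) i hΩfin J
  have hM0 : 0 ≤ bondNorm L m i.η (-(3 : ℝ)) i.Ω J := B8ScaledSupNorm.msup_nonneg L m hη.le _ _ _
  have hMf : ∀ y : {b : Site d × Fin d // P b}, ω (π y) * ‖f y‖ ≤ bondNorm L m i.η (-(3 : ℝ)) i.Ω J := by
    intro y
    have e3 : (-(3 : ℝ)) = -((3 : ℕ) : ℝ) := by norm_num
    have hw : weight L i.η (-(3 : ℝ)) (π y).1.1 = ((L : ℝ) ^ (π y).1.1 * i.η) ^ 3 := by rw [e3, B8ScaledSupNorm.weight_neg_natCast]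
    have hcls : BondTouches (i.Ω (π y).1.1) y.1.1 y.1.2 :=
      (hπ' y).imp (fun h => hT (π y) h) (fun h => hT (π y) h)
    have := weight_mul_norm_le_msup hBdd (π y).2.1 (i := (y.1.1, y.1.2)) hcls
    rw [hw] at this
    exact this
  -- `0 ≤ B₀`, or every class is empty
  by_cases hB₀ : 0 ≤ B₀
  · have h := holderBoth_msup_le_CH' (len := len) hL hB₀ h342 h345 hβ0 hβ1 hlen1 hlen (hlin U₀) π hπ' hπbase hPΩ hlev
      (κ₂ := 0) (exchangeConst_nonneg hω haH) (exchangeConst_nonneg hω ha1) hω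
      (fun u v => exchangeLetter_of_fintype hω haH u v) (fun u v => exchangeLetter_of_fintype hω ha1 u v)
      (fun u => by rw [sub_zero]; exact rowLetter_of_fintype hδ₀.le u) (Nat.cast_nonneg _) f hM0 hMf
    have hrw : (fun q : Fin d × Fin d × (Site d × Site d) =>
        hquot i.η β len U₀ (covDerivFwd i.η U₀ q.1 (fun z => (ops M i m).Gop U₀ J z q.2.1)) q.2.2) =
        (fun q : Fin d × Fin d × (Site d × Site d) =>
          hquot i.η β len U.1 (covDerivFwd i.η U.1 q.1 (fun z => (ops M i m).Gop U.1 (extZd P f) z q.2.1)) q.2.2) := by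
      funext q
      have : (fun z => (ops M i m).Gop U₀ J z q.2.1) = (fun z => (ops M i m).Gop U.1 (extZd P f) z q.2.1) := funext fun z => hGJ z q.2.1
      rw [this]
    rw [hrw]
    exact h
  · -- `B₀ < 0`: no block can carry a bond of `Ω₀` (else the bump contradicts (3.42)), so both weighted suprema run over empty index sets
    have hnone : ∀ j, j ≤ m → ∀ (z : Site d) (μ : Fin d), ¬ BondTouches (i.Ω j) z μ := by
      intro j hj z μ hb
      rcases hb with hz | hz
      · obtain ⟨y, hy⟩ := hcover j hj z hz
        exact hB₀ (B0_nonneg_of_ineq342_zd (len := len) hL h342 y hy μ)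
      · obtain ⟨y, hy⟩ := hcover j hj (z + e μ) hz
        exact hB₀ (B0_nonneg_of_ineq342_zd (len := len) hL h342 y hy μ)
    have hL0 : msup L m i.η (-(2 + β))
        (fun j (q : Fin d × Fin d × (Site d × Site d)) => q.2.2 ∈ AdmPair i.η len ∧ q.2.2.1 ∈ i.Ω j ∧ q.2.2.2 ∈ i.Ω j)
        (fun q => hquot i.η β len U₀ (covDerivFwd i.η U₀ q.1 (fun z => (ops M i m).Gop U₀ J z q.2.1)) q.2.2) = 0 := by
      haveI : IsEmpty (B8ScaledSupNorm.Idx m (fun j (q : Fin d × Fin d × (Site d × Site d)) =>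
          q.2.2 ∈ AdmPair i.η len ∧ q.2.2.1 ∈ i.Ω j ∧ q.2.2.2 ∈ i.Ω j)) :=
        ⟨fun p => hnone p.1.1 p.2.1 p.1.2.2.2.1 p.1.2.1 (Or.inl p.2.2.2.1)⟩
      exact Real.iSup_of_isEmpty _
    have hR0 : bondNorm L m i.η (-(3 : ℝ)) i.Ω J = 0 := by
      haveI : IsEmpty (B8ScaledSupNorm.Idx m (fun j (b : Site d × Fin d) => BondTouches (i.Ω j) b.1 b.2)) :=
        ⟨fun p => hnone p.1.1 p.2.1 p.1.2.1 p.1.2.2 p.2.2⟩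
      exact Real.iSup_of_isEmpty _
    rw [hL0, hR0, mul_zero]

end Discharge

end Literature.MathematicalPhysics.QuantumFieldTheory.Balaban1983to89.B9Eq343HolderDelta2ZdFinite

end
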